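import Literature.AnabelianGeometry.EtaleTheta.ThetaCovers
import HarnessLib

/-!
# [EtTh] §2: the commutator clause «`Δ̄_Θ` is the image of `⁅Δ_X, Δ_X⁆`» as a NAMED PREDICATE on the
# theta-covering interface `CoverData` (13:00Z v-next census item C13, predicate route)

Mochizuki, *The Étale Theta Function and its Frobenioid-theoretic Manifestations* [EtTh], Publ. RIMS 45
(2009): §1 p.12 «`Δ_Θ := Im(∧² Δ^ab_X)`» (i.e. `Δ_Θ = [Δ^Θ_X, Δ^Θ_X]`), §2 p.35 (the quotient `Δ̄_X` of
`Δ_X` with `Δ̄_Θ ≅ (ℤ/lℤ)(1)` central, `Δ̄^ell_X` free of rank 2) (locators `p.N` = PDF pages; bib key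
`MochizukiEtTh2009`). Seat abc-iut-L2-t2 (owner of `ThetaCovers.CoverData`, p405102/p427530), for the
13:00Z v-next census (plan/L2: VNEXT-S2 §S2-3, L2-t3 draft item C13; GAP-LEDGER G-L2d3-1).

WHY A PREDICATE AND NOT A FIELD (owner's ripple census, 2026-08-26T10:5xZ): the frozen `CoverData` has NINE
constructor sites in the tree, FIVE of which are ABELIAN toy / counter-models that violate the clause by
design and carry REFERENCED refutation theorems (`ThetaCoversAbelianWitness` p432019 — the independence
witness itself —, `ThetaCoversDihedralWitness`, `ThetaCoversProp22iSignToy(Independence)`,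
`Discharge/Sec2Prop22iRmk211BareNegative` (F-0599), `ThetaCoversTemperedModelDefs` (w5-d118's first model));
a structure FIELD would un-build them (and bounce `lint.removes-referenced-decl` on any rewrite). The
genuine, setting-born cover data get the clause as a THEOREM (abc-iut-L2-t11 `IsEtThOrigin.commutator_sup_barKerHat`
R158, abc-iut-L2-t10 `PiCData.coverDataAx_hTheta` p431249; NV at `modelχ`/`modelχ′`, R208), and every consumer
(`rmk261_of`, `cor29_card_of`, `natCard_cuspOrbits_tpPiXuu`, `Sec2BarDeltaHTheta`, `Sec2AutKPairing`) already
takes it BY NAME as the binder `hΘ`. This file only NAMES that binder, so tokens/NV lines can cite one decl: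

* `CoverData.IsCommutatorTheta X : Prop` — `@[mk_iff]` one-clause structure
  `⁅X.DeltaX, X.DeltaX⁆ ⊔ X.barKer = X.barTheta` (DEFINITIONAL predicate with the cover datum as parameter,
  class (c) — not a zero-argument fact; `⟨hΘ⟩` / `.commutator_sup_barKer` convert with the binder `hΘ`);
* `isCommutatorTheta_iff` (generated), `commutator_sup_barKer_le_deltaX` (holds for EVERY `CoverData`:
  both pieces lie in `Δ_X`), `IsCommutatorTheta.commutator_le_barTheta` / `.barTheta_le` (the two
  inclusions packaged for consumers).

FILED for the author by abc-iut-w6-d092 (gen 4) per abc-iut-L2-lead R268 (author seat abc-iut-L2-t2 g4 closed 10:59:16Z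
«any seat can»); author's staged text (HOME/staging/L2/L2-t2/census/, 2026-08-26T10:47Z) UNCHANGED apart from this
sentence and the `HarnessLib` import. HONEST FRAMING: a schema item (the printed DEFINITION of `Δ_Θ`) that the typed interface omits; naming it
asserts nothing; no side taken on [IUTchIII] Cor 3.12; typed ≠ proved.
-/

namespace Literature.AnabelianGeometry.EtaleTheta.ThetaCovers.CoverData

universe u

variable {l : ℕ} (X : CoverData.{u} l)

/-- **«`Δ_Θ := Im(∧² Δ^ab_X)`» for a theta-covering datum** (§1 p.12; §2 p.35: `Δ̄_Θ` is the image of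
the commutator subgroup of `Δ_X` in `Δ̄_X`), pulled back to `Π_C`: `⁅Δ_X, Δ_X⁆ · Ker(Δ_X ↠ Δ̄_X)` is the
inverse image of `Δ̄_Θ`. The binder `hΘ` of Rmk 2.6.1 / Cor 2.9 / the `Aut_K`-pairing files, named.
[cite: MochizukiEtTh2009, Def 2.1 p.35] -/
@[mk_iff]
structure IsCommutatorTheta : Prop where
  /-- `⁅Δ_X, Δ_X⁆ · Ker(Δ_X ↠ Δ̄_X)` is the inverse image of `Δ̄_Θ` (p.35) -/
  commutator_sup_barKer : ⁅X.DeltaX, X.DeltaX⁆ ⊔ X.barKer = X.barTheta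

/-- The inclusion `⁅Δ_X, Δ_X⁆ · Ker ≤ Δ_X` holds for EVERY cover datum (both pieces lie in `Δ_X`); the
content of the clause is the comparison with the `Δ̄_Θ`-preimage. [cite: MochizukiEtTh2009, Def 2.1 p.35] -/
theorem commutator_sup_barKer_le_deltaX : ⁅X.DeltaX, X.DeltaX⁆ ⊔ X.barKer ≤ X.DeltaX :=
  sup_le (Subgroup.commutator_le.2 fun _ ha _ hb =>
      X.DeltaX.mul_mem (X.DeltaX.mul_mem (X.DeltaX.mul_mem ha hb) (X.DeltaX.inv_mem ha))
        (X.DeltaX.inv_mem hb))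
    (X.barKer_le_barTheta.trans X.barTheta_le)

/-- Under the clause, `Δ̄_Θ`-preimage `= ⁅Δ_X, Δ_X⁆ · Ker`; in particular the commutator subgroup of `Δ_X`
lies in the `Δ̄_Θ`-preimage ("`Δ̄^ell_X = Δ̄_X/Δ̄_Θ` is abelian", p.35). [cite: MochizukiEtTh2009, Def 2.1 p.35] -/
theorem IsCommutatorTheta.commutator_le_barTheta (h : X.IsCommutatorTheta) :
    ⁅X.DeltaX, X.DeltaX⁆ ≤ X.barTheta :=
  le_sup_left.trans h.commutator_sup_barKer.le

/-- Under the clause, `Ker(Δ_X ↠ Δ̄_X) · ⁅Δ_X, Δ_X⁆ ⊇ Δ̄_Θ`-preimage: every element of the `Δ̄_Θ`-preimage is a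
product of commutators modulo `Ker`. [cite: MochizukiEtTh2009, Def 2.1 p.35] -/
theorem IsCommutatorTheta.barTheta_le (h : X.IsCommutatorTheta) :
    X.barTheta ≤ ⁅X.DeltaX, X.DeltaX⁆ ⊔ X.barKer :=
  h.commutator_sup_barKer.ge

end Literature.AnabelianGeometry.EtaleTheta.ThetaCovers.CoverData
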